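import Summits.ValiantsHypothesis.ValiantsHypothesis.Theorems.MonotoneRestorationOrbitRestorationQPWaringJennrichOrbit
import HarnessLib

/-!
# A_∞ on the Jennrich stratum of ΣΛΣ, affine forms

Route MonotoneRestoration, crux `OrbitRestorationQP` (stmt-ValiantsHypothesis-18293), line `depth-three-rung`,
stub A_∞ `stub_sigmaPiSigmaValue`.  Namespace `Summit.ValiantsHypothesis.ValiantsHypothesis.Theorems.WaringJennrich`.

`…WaringJennrichOrbit.lean` restores symmetry for invariant sums of powers of linearly independent LINEAR
forms.  Depth-3 powering circuits use AFFINE forms `ℓ = Σ_x w_x X_x + b`; this file removes that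
restriction (the linear parts are still required to be linearly independent):

* `homogeneousComponent_top_affPow` — the top homogeneous component of `a (ℓ_w + b)^d` is `a ℓ_w^d`, so
  Jennrich's theorem for the linear parts applies to an identity between affine Waring expressions;
* `iterate_D_affPow` — `(D u)^m (a (ℓ_w + b)^e)` (the directional derivative does not see the constant);
* `jennrich_affine_terms` — **uniqueness for affine Waring decompositions with independent linear parts**
  (`d ≥ 3`): the affine forms of the second decomposition are scalar multiples of those of the first,
  `m_j = c_j (ℓ_{w_{k_j}} + b_{k_j})`, `k` injective, `a'_j c_j^d = a_{k_j}` (the constants are recovered by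
  applying `(D u_{k_j})^{d-1}`, which leaves the affine form itself);
* `ncard_orbit_aff_le`, `qpOrbitRestorable_of_independentAffineWaring`,
  `sigmaLambdaSigma_jennrich_restoration_affine` — **every matrix-symmetric family that is, at each level, a
  sum of `≤ n^c₀+c₀` nonzero multiples of `d`-th powers (`3 ≤ d ≤ n^c₀+c₀`) of affine forms with linearly
  independent linear parts is quasi-polynomially orbit-restorable** (unbounded top fan-in).

Honest label: sub-rung of A_∞ (identifiable ΣΛΣ); A_∞ and the crux stay open; VP ≠ VNP untouched. [folklore]
-/

noncomputable section

open scoped Classical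

-- `Summit.ValiantsHypothesis.ValiantsHypothesis.…` is the tree's single-conjunct layout (Sub = Summit).
set_option linter.dupNamespace false

namespace Summit.ValiantsHypothesis.ValiantsHypothesis.Theorems

namespace WaringJennrich

open MvPolynomial Finset OrbitRestorationQPDepthThreeRung

universe u v

section General

variable {K : Type u} [Field K] {X : Type v} [Fintype X]

/-! ### Affine powers: top component and directional derivatives -/

/-- A linear form is homogeneous of degree `1`. [folklore] -/
theorem isHomogeneous_lin (w : X → K) : (lin w).IsHomogeneous 1 := by
  unfold lin
  exact IsHomogeneous.sum _ _ _ fun x _ => (isHomogeneous_X K x).C_mul (w x)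

/-- **The top homogeneous component of a scaled power of an affine form is the power of its linear part.**
[folklore] -/
theorem homogeneousComponent_top_affPow (w : X → K) (b a : K) (d : ℕ) :
    homogeneousComponent d (C a * (lin w + C b) ^ d) = C a * lin w ^ d := by
  rw [homogeneousComponent_C_mul]
  congr 1
  rw [add_pow, map_sum]
  have hterm : ∀ m : ℕ, lin w ^ m * C b ^ (d - m) * (d.choose m : MvPolynomial X K) =
      C (b ^ (d - m) * (d.choose m : K)) * lin w ^ m := fun m => by
    rw [map_mul, map_pow, map_natCast]; ring
  have hhom : ∀ m : ℕ, C (b ^ (d - m) * (d.choose m : K)) * lin w ^ m ∈ homogeneousSubmodule X K m := by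
    intro m
    rw [mem_homogeneousSubmodule]
    have h1 : (lin w ^ m).IsHomogeneous m := by simpa using (isHomogeneous_lin w).pow m
    exact h1.C_mul _
  rw [Finset.sum_congr rfl fun m _ => by rw [hterm, homogeneousComponent_of_mem (hhom m)],
    Finset.sum_ite_eq, if_pos (Finset.mem_range.2 (Nat.lt_succ_self d)), Nat.sub_self, pow_zero, one_mul,
    Nat.choose_self, Nat.cast_one, map_one, one_mul]

/-- `D u` of an affine form is the pairing of its linear part with `u`. [folklore] -/
theorem D_aff (u w : X → K) (b : K) : D u (lin w + C b) = C (pair w u) := by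
  rw [map_add, D_lin, D_C, add_zero]

omit [Fintype X] in
/-- Iterated directional derivatives of a scaled power of an element with constant derivative. [folklore] -/
theorem iterate_D_C_mul_pow_of (u : X → K) {ℓ : MvPolynomial X K} {t : K} (hℓ : D u ℓ = C t) (a : K)
    (e : ℕ) : ∀ m : ℕ, (D u)^[m] (C a * ℓ ^ e) = C (a * (e.descFactorial m : K) * t ^ m) * ℓ ^ (e - m)
  | 0 => by simp
  | m + 1 => by
      rw [Function.iterate_succ_apply', iterate_D_C_mul_pow_of u hℓ a e m, D_C_mul,
        (D u).leibniz_pow, hℓ, Nat.descFactorial_succ, smul_eq_mul, nsmul_eq_mul]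
      have h : e - (m + 1) = e - m - 1 := by omega
      rw [h]
      simp only [Nat.cast_mul, map_mul, map_natCast, pow_succ]
      ring

/-- **Iterated directional derivative of an affine Waring expression.** [folklore] -/
theorem iterate_D_affSum {ι : Type*} [Fintype ι] (u : X → K) (a : ι → K) (v : ι → X → K) (b : ι → K)
    (d m : ℕ) :
    (D u)^[m] (∑ i, C (a i) * (lin (v i) + C (b i)) ^ d) =
      ∑ i, C (a i * (d.descFactorial m : K) * pair (v i) u ^ m) * (lin (v i) + C (b i)) ^ (d - m) := by
  rw [iterate_D_eq_pow, map_sum]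
  exact Finset.sum_congr rfl fun i _ => by
    rw [← iterate_D_eq_pow, iterate_D_C_mul_pow_of u (D_aff u (v i) (b i))]

/-! ### Jennrich for affine forms -/

variable [CharZero K]

/-- **Uniqueness of affine Waring decompositions with independent linear parts.**  If
`Σ_i a_i (ℓ_{w_i} + b_i)^d = Σ_j a'_j (ℓ_{v_j} + b'_j)^d` with `w` and `v` linearly independent, all
`a_i ≠ 0`, `d ≥ 3` and `|J| ≤ |ι|`, then there are an injective `k : J → ι` and scalars `c_j` with
`ℓ_{v_j} + b'_j = c_j (ℓ_{w_{k_j}} + b_{k_j})` and `a'_j c_j^d = a_{k_j}`: the terms agree. [folklore] -/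
theorem jennrich_affine_terms {ι J : Type*} [Fintype ι] [Fintype J] (w : ι → X → K) (b a : ι → K)
    (v : J → X → K) (b' a' : J → K) {d : ℕ} (hw : LinearIndependent K w) (ha : ∀ i, a i ≠ 0)
    (hd : 3 ≤ d) (hcard : Fintype.card J ≤ Fintype.card ι) (hv : LinearIndependent K v)
    (h : ∑ i, C (a i) * (lin (w i) + C (b i)) ^ d = ∑ j, C (a' j) * (lin (v j) + C (b' j)) ^ d) :
    ∃ (k : J → ι) (c : J → K), Function.Injective k ∧
      (∀ j, lin (v j) + C (b' j) = C (c j) * (lin (w (k j)) + C (b (k j)))) ∧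
        ∀ j, a' j * c j ^ d = a (k j) := by
  -- top homogeneous components: an identity between LINEAR Waring expressions
  have htop := congrArg (homogeneousComponent d) h
  rw [map_sum, map_sum] at htop
  simp only [homogeneousComponent_top_affPow] at htop
  obtain ⟨k, c, hinj, hkc, hcoef⟩ := jennrich_terms w a v a' hw ha hd hcard hv htop
  refine ⟨k, c, hinj, fun j => ?_, hcoef⟩
  have hc0 : a' j * c j ^ (d - 1) ≠ 0 := by
    have h1 : a' j * c j ^ d ≠ 0 := by rw [hcoef j]; exact ha (k j)
    refine mul_ne_zero (left_ne_zero_of_mul h1) (pow_ne_zero _ fun hc => h1 ?_)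
    rw [hc, zero_pow (by omega), mul_zero]
  -- apply `(D u_{k j})^{d-1}`: it leaves the affine forms themselves
  obtain ⟨u, hu⟩ := exists_dual w hw
  have hk := congrArg ((D (u (k j)))^[d - 1]) h
  rw [iterate_D_affSum, iterate_D_affSum] at hk
  have hd1 : d - (d - 1) = 1 := by omega
  rw [hd1] at hk
  simp only [pow_one] at hk
  rw [Finset.sum_eq_single (k j) (fun i _ hi => by
      rw [hu (k j) i, if_neg hi, zero_pow (by omega), mul_zero, map_zero, zero_mul])
    (fun h' => (h' (Finset.mem_univ _)).elim), hu (k j) (k j), if_pos rfl, one_pow, mul_one] at hk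
  have hpair : ∀ j', pair (v j') (u (k j)) = if j' = j then c j else 0 := by
    intro j'
    rw [hkc j', pair_smul, hu (k j) (k j')]
    by_cases hj' : j' = j
    · subst hj'; simp
    · rw [if_neg (fun h' => hj' (hinj h')), if_neg hj', mul_zero]
  simp only [hpair] at hk
  rw [Finset.sum_eq_single j (fun j' _ hj' => by
      rw [if_neg hj', zero_pow (by omega), mul_zero, map_zero, zero_mul])
    (fun h' => (h' (Finset.mem_univ _)).elim), if_pos rfl] at hk
  -- `hk : C (a (k j) * (d-1)!') * ℓ_{k j} = C (a' j * … * c j ^ (d-1)) * m_j`; substitute `a (k j)`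
  rw [← hcoef j] at hk
  have hfact : ((d.descFactorial (d - 1) : ℕ) : K) ≠ 0 := by
    have : d.descFactorial (d - 1) ≠ 0 := by rw [Ne, Nat.descFactorial_eq_zero_iff_lt]; omega
    exact_mod_cast this
  -- cancel the common nonzero scalar `a' j * (d)_(d-1) * c j ^ (d-1)`
  have key : C (a' j * (d.descFactorial (d - 1) : K) * c j ^ (d - 1)) *
      (C (c j) * (lin (w (k j)) + C (b (k j)))) =
      C (a' j * (d.descFactorial (d - 1) : K) * c j ^ (d - 1)) * (lin (v j) + C (b' j)) := by
    rw [← hk, ← mul_assoc, ← map_mul]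
    congr 2
    have : c j ^ d = c j ^ (d - 1) * c j := by rw [← pow_succ]; congr 1; omega
    rw [this]; ring
  have hne : C (a' j * (d.descFactorial (d - 1) : K) * c j ^ (d - 1)) ≠ (0 : MvPolynomial X K) := by
    rw [Ne, C_eq_zero]
    exact mul_ne_zero (mul_ne_zero (left_ne_zero_of_mul hc0) hfact) (right_ne_zero_of_mul hc0)
  exact (mul_left_cancel₀ hne key).symm

end General

/-! ### The diagonal action: orbits of affine forms and restorability -/

variable {n : ℕ}

/-- `ren σ` of an affine form. [folklore] -/
theorem ren_aff (σ : Equiv.Perm (Fin n)) (w : (Fin n × Fin n) → ℂ) (b : ℂ) :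
    ren σ (lin w + C b) = lin (fun x => w (σ⁻¹ • x)) + C b := by
  rw [map_add, ren_lin, ren_C]

section Orbit

variable {r d : ℕ} (w : Fin r → (Fin n × Fin n) → ℂ) (b a : Fin r → ℂ)

/-- **Orbit of each affine form of an invariant independent affine Waring decomposition**: the images of
`ℓ_{w_j} + b_j` are `c (ℓ_{w_k} + b_k)` with `c^d = a_k / a_j`. [folklore] -/
theorem orbit_aff_subset (hd : 3 ≤ d) (hw : LinearIndependent ℂ w) (ha : ∀ i, a i ≠ 0)
    (hfix : ∀ σ : Equiv.Perm (Fin n), ren σ (∑ i, C (a i) * (lin (w i) + C (b i)) ^ d) =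
      ∑ i, C (a i) * (lin (w i) + C (b i)) ^ d) (j : Fin r) :
    (Set.range fun σ : Equiv.Perm (Fin n) => ren σ (lin (w j) + C (b j))) ⊆
      ↑((Finset.univ : Finset (Fin r)).biUnion fun k =>
        ((Polynomial.nthRoots d (a k / a j)).toFinset.image fun c => C c * (lin (w k) + C (b k)))) := by
  rintro _ ⟨σ, rfl⟩
  have h := hfix σ
  simp only [map_sum, map_mul, ren_C, map_pow, ren_aff] at h
  obtain ⟨k, c, hinj, hkc, hcoef⟩ :=
    jennrich_affine_terms w b a (fun i => fun x => w i (σ⁻¹ • x)) b a hw ha hd le_rfl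
      (linearIndependent_perm σ hw) h.symm
  simp only [Finset.coe_biUnion, Finset.coe_univ, Set.mem_univ, Set.iUnion_true, Set.mem_iUnion,
    Finset.coe_image, Set.mem_image, Finset.mem_coe, Multiset.mem_toFinset]
  refine ⟨k j, c j, ?_, ?_⟩
  · rw [Polynomial.mem_nthRoots (by omega), eq_div_iff (ha j), mul_comm]
    exact hcoef j
  · rw [ren_aff, hkc j]

/-- **Orbit bound** for the affine forms: at most `r · d` images. [folklore] -/
theorem ncard_orbit_aff_le (hd : 3 ≤ d) (hw : LinearIndependent ℂ w) (ha : ∀ i, a i ≠ 0)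
    (hfix : ∀ σ : Equiv.Perm (Fin n), ren σ (∑ i, C (a i) * (lin (w i) + C (b i)) ^ d) =
      ∑ i, C (a i) * (lin (w i) + C (b i)) ^ d) (j : Fin r) :
    (Set.range fun σ : Equiv.Perm (Fin n) => ren σ (lin (w j) + C (b j))).ncard ≤ r * d := by
  refine (Set.ncard_le_ncard (orbit_aff_subset w b a hd hw ha hfix j) (Finset.finite_toSet _)).trans ?_
  rw [Set.ncard_coe_finset]
  refine (Finset.card_biUnion_le).trans ?_
  calc ∑ k : Fin r, ((Polynomial.nthRoots d (a k / a j)).toFinset.image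
        fun c => C c * (lin (w k) + C (b k))).card
      ≤ ∑ _k : Fin r, d := Finset.sum_le_sum fun k _ =>
        Finset.card_image_le.trans ((Multiset.toFinset_card_le _).trans (Polynomial.card_nthRoots _ _))
    _ = r * d := by rw [Finset.sum_const, Finset.card_univ, Fintype.card_fin, smul_eq_mul]

end Orbit

/-- The tree's `affineForm` with constants `b` is `ℓ_w + b`. [folklore] -/
theorem affineForm_eq_aff {τ ι : Type} [Fintype τ] [Fintype ι] (w : τ → (Fin n × Fin n) → ℂ) (b : τ → ℂ)
    (s : τ) (i : ι) : ValueProducts.affineForm (fun s _ => b s) (fun s _ => w s) s i = lin (w s) + C (b s) := by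
  rw [ValueProducts.affineForm, add_comm, lin]

/-- **A_∞ on the affine Jennrich stratum, one level**: a diagonally `Sym(Fin n)`-invariant
`f = Σ_{i<r} a_i (ℓ_{w_i} + b_i)^d` with linearly independent `w`, nonzero `a_i`, `d ≥ 3` and
`r·d ≤ 2^((log₂ n + c)^c)` is `QPOrbitRestorable (c+5) n f`. [folklore] -/
theorem qpOrbitRestorable_of_independentAffineWaring {c r d : ℕ} (hd : 3 ≤ d)
    (w : Fin r → (Fin n × Fin n) → ℂ) (hw : LinearIndependent ℂ w) (b a : Fin r → ℂ) (ha : ∀ i, a i ≠ 0)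
    (hB : r * d ≤ 2 ^ ((Nat.log 2 n + c) ^ c)) {f : MvPolynomial (Fin n × Fin n) ℂ}
    (hf : f = ∑ i, C (a i) * (lin (w i) + C (b i)) ^ d) (hfix : ∀ σ : Equiv.Perm (Fin n), ren σ f = f) :
    QPOrbitRestorable (c + 5) n f := by
  have hfix' : ∀ σ : Equiv.Perm (Fin n), ren σ (∑ i, C (a i) * (lin (w i) + C (b i)) ^ d) =
      ∑ i, C (a i) * (lin (w i) + C (b i)) ^ d := by
    intro σ; rw [← hf]; exact hfix σ
  have horb := ncard_orbit_aff_le w b a hd hw ha hfix'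
  refine ValueProducts.qpOrbitRestorable_of_affineProductTerms (τ := Fin r) (ι := Fin d)
    (fun s _ => b s) (fun s _ => w s) a (fun s i => ?_) (fun s => ?_) ?_ hfix
  · rw [affineForm_eq_aff]
    exact (horb s).trans hB
  · have hfac : ∀ σ : Equiv.Perm (Fin n),
        ((Finset.univ : Finset (Fin d)).val.map
          (ValueProducts.affineForm (fun s _ => b s) (fun s _ => w s) s)).map (ren σ) =
        (Finset.univ : Finset (Fin d)).val.map (fun _ => ren σ (lin (w s) + C (b s))) := by
      intro σ
      rw [Multiset.map_map]
      refine Multiset.map_congr rfl fun i _ => ?_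
      simp only [Function.comp_apply, affineForm_eq_aff]
    refine (TermCircuit.ncard_range_le_of_factor _
      (fun σ : Equiv.Perm (Fin n) => ren σ (lin (w s) + C (b s)))
      (fun q => (Finset.univ : Finset (Fin d)).val.map fun _ => q) hfac).trans ?_
    exact (horb s).trans hB
  · rw [hf]
    refine Finset.sum_congr rfl fun s _ => ?_
    rw [Finset.prod_congr rfl fun i _ => affineForm_eq_aff w b s i, Finset.prod_const, Finset.card_univ,
      Fintype.card_fin]

/-- **A_∞ ON THE AFFINE JENNRICH STRATUM OF ΣΛΣ (family form).**  Every matrix-symmetric family `f` which at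
every level `n` is a sum of at most `n^c₀ + c₀` nonzero multiples of `d_n`-th powers, `3 ≤ d_n ≤ n^c₀ + c₀`,
of AFFINE forms whose linear parts are linearly independent is quasi-polynomially orbit-restorable — an
unbounded-top-fan-in instance of `stub_sigmaPiSigmaValue` (A_∞) of line `depth-three-rung`. [folklore] -/
theorem sigmaLambdaSigma_jennrich_restoration_affine (f : (n : ℕ) → MvPolynomial (Fin n × Fin n) ℂ)
    (hsym : IsMatrixSymmetric f)
    (h : ∃ c₀ : ℕ, ∀ n : ℕ, ∃ (r d : ℕ) (w : Fin r → (Fin n × Fin n) → ℂ) (b a : Fin r → ℂ),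
      3 ≤ d ∧ r ≤ n ^ c₀ + c₀ ∧ d ≤ n ^ c₀ + c₀ ∧ LinearIndependent ℂ w ∧ (∀ i, a i ≠ 0) ∧
        f n = ∑ i, C (a i) * (lin (w i) + C (b i)) ^ d) :
    ∃ c : ℕ, ∀ n : ℕ, QPOrbitRestorable c n (f n) := by
  obtain ⟨c₀, hc₀⟩ := h
  obtain ⟨c, hc⟩ := sq_polyBound_le_qp c₀
  refine ⟨c + 5, fun n => ?_⟩
  obtain ⟨r, d, w, b, a, hd, hr, hdle, hw, ha, hf⟩ := hc₀ n
  refine qpOrbitRestorable_of_independentAffineWaring hd w hw b a ha ?_ hf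
    (ValueOrbit.ren_eq_of_matrixSymmetric (hsym n))
  exact (Nat.mul_le_mul hr hdle).trans (hc n)

end WaringJennrich

end Summit.ValiantsHypothesis.ValiantsHypothesis.Theorems

end
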